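import Literature.NumberTheory.EllipticCurves.Sha
import HarnessLib

/-!
# BirchSwinnertonDyer / LeadingTerm — crux `TamePinchR` (stmt-BirchSwinnertonDyer-17007),
# line `Sketch`, stub **B** `stub_shaTorsionCofinite`

Registered stub **B** of the skeleton `Cruxes/TamePinchR/Lines/Sketch.lean`: if the
Tate–Shafarevich group `Ш(E/ℚ) = W.sha` of an elliptic curve over `ℚ` is finite, then for all
primes `p` outside a finite set the `p`-torsion of `Ш` is trivial, `Ш[p] = 0`.

Proof (pure group theory, Lagrange): take `S` = the prime factors of `#Ш = Nat.card W.sha`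
(positive, `Ш` being finite and nonempty). For a prime `p ∉ S` and `x ∈ Ш` with `p • x = 0`,
`addOrderOf x` divides `p` and divides `#Ш` (`addOrderOf_dvd_natCard`), hence divides
`gcd(p, #Ш) = 1` (`p ∤ #Ш` as `p ∉ S`), so `addOrderOf x = 1` and `x = 0`.
-/

set_option linter.dupNamespace false

noncomputable section

namespace Summit.BirchSwinnertonDyer.BirchSwinnertonDyer.Theorems

open scoped Classical
open Literature.NumberTheory.EllipticCurves WeierstrassCurve

/-- In a finite additive group `A`, for every prime `p` not dividing `#A` the `p`-torsion is
trivial: if `p • x = 0` then `x = 0` (Lagrange: `addOrderOf x ∣ gcd(p, #A) = 1`). Stated with the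
finite exceptional set `S = (Nat.card A).primeFactors` and the `ℤ`-scalar `(p : ℤ) • x`. [folklore] -/
theorem stubB_zsmul_eq_zero_cofinite (A : Type*) [AddGroup A] [Finite A] :
    ∃ S : Finset ℕ, ∀ p ∉ S, p.Prime → ∀ x : A, (p : ℤ) • x = 0 → x = 0 := by
  refine ⟨(Nat.card A).primeFactors, fun p hp hpp x hx ↦ ?_⟩
  have hcard : Nat.card A ≠ 0 := by
    haveI : Nonempty A := ⟨0⟩
    exact (Nat.card_pos (α := A)).ne'
  have hndvd : ¬ p ∣ Nat.card A := fun h ↦ hp (Nat.mem_primeFactors.mpr ⟨hpp, h, hcard⟩)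
  have h1 : addOrderOf x ∣ p := by
    rw [natCast_zsmul] at hx
    exact addOrderOf_dvd_iff_nsmul_eq_zero.mpr hx
  have h2 : addOrderOf x ∣ Nat.card A := addOrderOf_dvd_natCard x
  have hgcd : Nat.gcd p (Nat.card A) = 1 := (hpp.coprime_iff_not_dvd.mpr hndvd).gcd_eq_one
  have h3 : addOrderOf x ∣ 1 := hgcd ▸ Nat.dvd_gcd h1 h2
  exact AddMonoid.addOrderOf_eq_one_iff.mp (Nat.dvd_one.mp h3)

/-- Stub **B** (finite `Ш` ⇒ `Ш[p] = 0` for almost all `p`). If `Ш(E/ℚ)` is finite then for every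
prime `p` not dividing `#Ш` the `p`-torsion of `Ш` vanishes (Lagrange: the additive order of a
`p`-torsion class divides `gcd(p, #Ш) = 1`). Silverman, *AEC*, X.§4. [folklore] -/
theorem stub_shaTorsionCofinite :
    ∀ (W : WeierstrassCurve ℚ) [W.IsElliptic], Finite W.sha →
      ∃ S : Finset ℕ, ∀ p ∉ S, p.Prime → ∀ x : W.sha, (p : ℤ) • x = 0 → x = 0 := by
  intro W _ hfin
  exact stubB_zsmul_eq_zero_cofinite W.sha

end Summit.BirchSwinnertonDyer.BirchSwinnertonDyer.Theorems

end
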